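import Summits.Ventures.PercRepro.C041TriDomRedundantEdge

/-!
# ROW C-041 — THEOREM (PARALLEL PAIR): THE CONNECTIVITIES
(p6, gen 46; P6-TWOEXIT-LEAN.md §53 ADDENDUM 17)

A PARALLEL PAIR (`Parallel`): two free edges `f₁ = a–b`, `f₁' = a'–b'` with `a ≡ a'` and `b ≡ b'` through double
edges (parallel in the contracted multigraph).  The two derived statuses of THE TWO-EXIT COUNT: `stAbs st f₁` (`f₁`
deleted — when the pair has ONE colour the survivor `f₁'` carries it: `RdS_parallel_same`, `MgS_parallel_same`) and
`stAbs (stCon st f₁) f₁'` (`f₁` contracted and `f₁'` deleted — when the pair has TWO colours it is present in both,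
which is `f₁` double, and `f₁'` is then redundant: `RdS_parallel_diff`, `MgS_parallel_diff`).  The connectivities of
the first ignore the colour of `f₁`, those of the second the colours of both (`RdS_stAbs_congr`, `RdS_stAbsCon_congr`).
Everything rests on the implied-edge lemma of `C041TriDomRedundantEdge` in two forms: deleting an edge whose ends stay
connected (`RdS_eq_stAbs_of`) and contracting an edge whose ends are connected anyway (`RdS_stCon_eq_of`).  The
domination theorems are `C041TriDomParallelInduction`.
-/

namespace PercRepro

namespace ZoneZ

namespace MultiExit

open ZoneData Finset

variable {V₁ E₁ U₁ U₂ : Type} (Z₁ : ZoneData V₁ E₁ U₁ U₂) [DecidableEq E₁]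

variable {st : E₁ → EStat} {f : E₁}

/-! ## THEOREM (PARALLEL PAIR): the connectivities -/

/-- Deleting an edge changes no red connectivity if, whenever it is red, its ends stay red-connected. -/
theorem RdS_eq_stAbs_of {a b : V₁} (hj : Z₁.Joins f a b) (ω : E₁ → Bool)
    (h : redE st ω f → RdS Z₁ (stAbs st f) ω a b) : RdS Z₁ st ω = RdS Z₁ (stAbs st f) ω := by
  funext x y
  apply propext
  by_cases hf : redE st ω f
  · exact RdS_stAbs_iff_of_rd Z₁ hj ω (h hf) x y
  · unfold RdS
    rw [RAdjS_stAbs_eq_of_not_red Z₁ ω hf]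

/-- Deleting an edge changes no blue connectivity if, whenever it is blue, its ends stay blue-connected. -/
theorem MgS_eq_stAbs_of {a b : V₁} (hj : Z₁.Joins f a b) (ω : E₁ → Bool)
    (h : blueE st ω f → MgS Z₁ (stAbs st f) ω a b) : MgS Z₁ st ω = MgS Z₁ (stAbs st f) ω := by
  funext x y
  apply propext
  by_cases hf : blueE st ω f
  · exact MgS_stAbs_iff_of_mg Z₁ hj ω (h hf) x y
  · unfold MgS
    rw [BAdjS_stAbs_eq_of_not_blue Z₁ ω hf]

/-- Contracting a free edge changes no red connectivity if, whenever it is blue, its ends are red-connected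
anyway. -/
theorem RdS_stCon_eq_of {a b : V₁} (hf : st f = EStat.free) (hj : Z₁.Joins f a b) (ω : E₁ → Bool)
    (h : ω f = false → RdS Z₁ st ω a b) : RdS Z₁ (stCon st f) ω = RdS Z₁ st ω := by
  rcases Bool.eq_false_or_eq_true (ω f) with h₁ | h₁
  · unfold RdS
    rw [RAdjS_stCon_eq_of_red Z₁ hf ω h₁]
  · funext x y
    apply propext
    unfold RdS
    rw [RAdjS_eq_AdjCol, RAdjS_eq_AdjCol]
    exact reach_iff_of_implied_edge Z₁ hj (redE_stCon ω) (h h₁) x y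

/-- Contracting a free edge changes no blue connectivity if, whenever it is red, its ends are blue-connected
anyway. -/
theorem MgS_stCon_eq_of {a b : V₁} (hf : st f = EStat.free) (hj : Z₁.Joins f a b) (ω : E₁ → Bool)
    (h : ω f = true → MgS Z₁ st ω a b) : MgS Z₁ (stCon st f) ω = MgS Z₁ st ω := by
  rcases Bool.eq_false_or_eq_true (ω f) with h₁ | h₁
  · funext x y
    apply propext
    unfold MgS
    rw [BAdjS_eq_AdjCol, BAdjS_eq_AdjCol]
    exact reach_iff_of_implied_edge Z₁ hj (blueE_stCon ω) (h h₁) x y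
  · unfold MgS
    rw [BAdjS_stCon_eq_of_blue Z₁ hf ω h₁]

variable {f₁ f₁' : E₁} {a b a' b' : V₁}

/-- Double edges of `st` are double in `stCon st f₁`. -/
theorem DConn_stCon_of {x y : V₁} (h : DConn Z₁ st x y) : DConn Z₁ (stCon st f₁) x y := by
  refine reach_mono (fun p q hpq => AdjCol_mono Z₁ (fun e he => ?_) p q hpq) h
  show stCon st f₁ e = EStat.double
  unfold stCon
  by_cases hef : e = f₁
  · rw [if_pos hef]
  · rw [if_neg hef]
    exact he

/-- A parallel pair: two free edges `f₁ = a–b`, `f₁' = a'–b'` with `a ≡ a'`, `b ≡ b'`. -/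
structure Parallel (st : E₁ → EStat) (f₁ f₁' : E₁) (a b a' b' : V₁) : Prop where
  /-- the two edges are distinct -/
  hne : f₁ ≠ f₁'
  /-- `f₁` is free -/
  hs₁ : st f₁ = EStat.free
  /-- `f₁'` is free -/
  hs₁' : st f₁' = EStat.free
  /-- `f₁` joins `a` and `b` -/
  hj : Z₁.Joins f₁ a b
  /-- `f₁'` joins `a'` and `b'` -/
  hj' : Z₁.Joins f₁' a' b'
  /-- `a ≡ a'` -/
  haa : DConn Z₁ st a a'
  /-- `b ≡ b'` -/
  hbb : DConn Z₁ st b b'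

/-- THE SAME COLOUR: the red connectivity of `st` is that of `st` with `f₁` deleted. -/
theorem RdS_parallel_same (hP : Parallel Z₁ st f₁ f₁' a b a' b') (ω : E₁ → Bool) (h : ω f₁ = ω f₁') :
    RdS Z₁ st ω = RdS Z₁ (stAbs st f₁) ω := by
  refine RdS_eq_stAbs_of Z₁ hP.hj ω fun hf => ?_
  have haa := hP.haa
  have hbb := hP.hbb
  rw [← DConn_stAbs Z₁ hP.hs₁] at haa hbb
  refine RdS_of_parallel_red Z₁ hP.hj' haa hbb ω ?_
  rw [redE_stAbs]
  refine ⟨?_, hP.hne.symm⟩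
  rw [redE_free_iff hP.hs₁', ← h]
  exact (redE_free_iff hP.hs₁ ω).mp hf

/-- THE SAME COLOUR: the blue connectivity of `st` is that of `st` with `f₁` deleted. -/
theorem MgS_parallel_same (hP : Parallel Z₁ st f₁ f₁' a b a' b') (ω : E₁ → Bool) (h : ω f₁ = ω f₁') :
    MgS Z₁ st ω = MgS Z₁ (stAbs st f₁) ω := by
  refine MgS_eq_stAbs_of Z₁ hP.hj ω fun hf => ?_
  have haa := hP.haa
  have hbb := hP.hbb
  rw [← DConn_stAbs Z₁ hP.hs₁] at haa hbb
  refine MgS_of_parallel_blue Z₁ hP.hj' haa hbb ω ?_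
  rw [blueE_stAbs]
  refine ⟨?_, hP.hne.symm⟩
  rw [blueE_free_iff hP.hs₁', ← h]
  exact (blueE_free_iff hP.hs₁ ω).mp hf

/-- DIFFERENT COLOURS, first step: the red connectivity of `st` is that of `st` with `f₁` contracted. -/
theorem RdS_parallel_con (hP : Parallel Z₁ st f₁ f₁' a b a' b') (ω : E₁ → Bool) (h : ω f₁ ≠ ω f₁') :
    RdS Z₁ (stCon st f₁) ω = RdS Z₁ st ω := by
  refine RdS_stCon_eq_of Z₁ hP.hs₁ hP.hj ω fun h₁ => ?_
  refine RdS_of_parallel_red Z₁ hP.hj' hP.haa hP.hbb ω ?_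
  rw [redE_free_iff hP.hs₁']
  rcases Bool.eq_false_or_eq_true (ω f₁') with h₂ | h₂
  · exact h₂
  · exact absurd (h₁.trans h₂.symm) h

/-- DIFFERENT COLOURS, first step: the blue connectivity of `st` is that of `st` with `f₁` contracted. -/
theorem MgS_parallel_con (hP : Parallel Z₁ st f₁ f₁' a b a' b') (ω : E₁ → Bool) (h : ω f₁ ≠ ω f₁') :
    MgS Z₁ (stCon st f₁) ω = MgS Z₁ st ω := by
  refine MgS_stCon_eq_of Z₁ hP.hs₁ hP.hj ω fun h₁ => ?_
  refine MgS_of_parallel_blue Z₁ hP.hj' hP.haa hP.hbb ω ?_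
  rw [blueE_free_iff hP.hs₁']
  rcases Bool.eq_false_or_eq_true (ω f₁') with h₂ | h₂
  · exact absurd (h₁.trans h₂.symm) h
  · exact h₂

/-- `f₁'` is free in `stCon st f₁`. -/
theorem stCon_free_other (hP : Parallel Z₁ st f₁ f₁' a b a' b') : stCon st f₁ f₁' = EStat.free := by
  unfold stCon
  rw [if_neg hP.hne.symm]
  exact hP.hs₁'

/-- `f₁` is double in `stCon st f₁`. -/
theorem dconn_stCon_self (hj : Z₁.Joins f₁ a b) : DConn Z₁ (stCon st f₁) a b :=
  (mem_reach_singleton _ _ _).mpr (Relation.ReflTransGen.single ⟨f₁, hj, by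
    show stCon st f₁ f₁ = EStat.double
    unfold stCon
    rw [if_pos rfl]⟩)

/-- DIFFERENT COLOURS, second step: the red connectivity of `st` with `f₁` contracted is that with `f₁'` deleted
too (`f₁'` is then redundant: its ends are joined by `a' ≡ a —f₁— b ≡ b'`). -/
theorem RdS_parallel_diff (hP : Parallel Z₁ st f₁ f₁' a b a' b') (ω : E₁ → Bool) (h : ω f₁ ≠ ω f₁') :
    RdS Z₁ st ω = RdS Z₁ (stAbs (stCon st f₁) f₁') ω := by
  rw [← RdS_parallel_con Z₁ hP ω h]
  exact RdS_stAbs_eq_of_dconn Z₁ (stCon_free_other Z₁ hP) hP.hj'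
    (DConn_trans Z₁ (DConn_symm Z₁ (DConn_stCon_of Z₁ hP.haa))
      (DConn_trans Z₁ (dconn_stCon_self Z₁ hP.hj) (DConn_stCon_of Z₁ hP.hbb))) ω

/-- DIFFERENT COLOURS, second step, blue. -/
theorem MgS_parallel_diff (hP : Parallel Z₁ st f₁ f₁' a b a' b') (ω : E₁ → Bool) (h : ω f₁ ≠ ω f₁') :
    MgS Z₁ st ω = MgS Z₁ (stAbs (stCon st f₁) f₁') ω := by
  rw [← MgS_parallel_con Z₁ hP ω h]
  exact MgS_stAbs_eq_of_dconn Z₁ (stCon_free_other Z₁ hP) hP.hj'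
    (DConn_trans Z₁ (DConn_symm Z₁ (DConn_stCon_of Z₁ hP.haa))
      (DConn_trans Z₁ (dconn_stCon_self Z₁ hP.hj) (DConn_stCon_of Z₁ hP.hbb))) ω

/-- A free edge of `stAbs st f` is not `f`. -/
theorem ne_of_stAbs_free {e : E₁} (h : stAbs st f e = EStat.free) : e ≠ f := by
  intro he
  unfold stAbs at h
  rw [if_pos he] at h
  exact absurd h (by decide)

/-- The connectivities of `stAbs st f₁` ignore the colour of `f₁`. -/
theorem RdS_stAbs_congr {ω ω' : E₁ → Bool} (h : ∀ e, e ≠ f₁ → ω e = ω' e) :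
    RdS Z₁ (stAbs st f₁) ω = RdS Z₁ (stAbs st f₁) ω' :=
  RdS_congr_free Z₁ _ fun e he => h e (ne_of_stAbs_free he)

/-- The blue connectivities of `stAbs st f₁` ignore the colour of `f₁`. -/
theorem MgS_stAbs_congr {ω ω' : E₁ → Bool} (h : ∀ e, e ≠ f₁ → ω e = ω' e) :
    MgS Z₁ (stAbs st f₁) ω = MgS Z₁ (stAbs st f₁) ω' :=
  MgS_congr_free Z₁ _ fun e he => h e (ne_of_stAbs_free he)

/-- The connectivities of `stAbs (stCon st f₁) f₁'` ignore the colours of `f₁, f₁'`. -/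
theorem RdS_stAbsCon_congr {ω ω' : E₁ → Bool} (h : ∀ e, ¬ (e = f₁ ∨ e = f₁') → ω e = ω' e) :
    RdS Z₁ (stAbs (stCon st f₁) f₁') ω = RdS Z₁ (stAbs (stCon st f₁) f₁') ω' :=
  RdS_congr_free Z₁ _ fun e he => h e fun h' => h'.elim (fun h1 => ne_of_stCon_free
    (by unfold stAbs at he; rw [if_neg (ne_of_stAbs_free he)] at he; exact he) h1) (ne_of_stAbs_free he)

/-- The blue connectivities of `stAbs (stCon st f₁) f₁'` ignore the colours of `f₁, f₁'`. -/
theorem MgS_stAbsCon_congr {ω ω' : E₁ → Bool} (h : ∀ e, ¬ (e = f₁ ∨ e = f₁') → ω e = ω' e) :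
    MgS Z₁ (stAbs (stCon st f₁) f₁') ω = MgS Z₁ (stAbs (stCon st f₁) f₁') ω' :=
  MgS_congr_free Z₁ _ fun e he => h e fun h' => h'.elim (fun h1 => ne_of_stCon_free
    (by unfold stAbs at he; rw [if_neg (ne_of_stAbs_free he)] at he; exact he) h1) (ne_of_stAbs_free he)

end MultiExit

end ZoneZ

end PercRepro
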